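import Literature.NumberTheory.Automorphic.JordanZassenhaus
import HarnessLib

/-!
# The Jordan–Zassenhaus ∕ Dade–Taussky–Zassenhaus theorem for a CM-ALGEBRA `Y = L_1 ⊕ ⋯ ⊕ L_t` (any finite
# product of number fields): «for any order `Λ` in `A` the set `{[L]_ε | L ∈ 𝓛(A), 𝒪(L) ⊃ Λ}` of `ε`-classes of
# `Λ`-ideals is finite» (Hertling–Larabi 2026, Thm. 6.3) — the full `ℤ`-lattices `M ⊂ Y` with `MΛ ⊆ M` lie in
# FINITELY MANY `Y^×`-orbits, for EVERY full lattice `Λ ⊂ Y`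

Topic `Literature/NumberTheory/ComplexMultiplication`, namespace `Literature.NumberTheory.ComplexMultiplication`;
lane `lit-hodgefound` (Track 2 foundations library), Layer A3 («CM abelian varieties: construction from a CM type,
Shimura–Taniyama basics»), seat p19 generation 31, row g31-#1 — the lattice-level theorem behind g30-#3
(`CMAlgebraTorusIsomorphismClassesOrderFinite.lean`: finitely many `Y`-isomorphism classes of tori of type
`(Y; (Φᵢ))` whose order contains `N𝒪_Y`, proved there through explicit MODELS), stated and proved in the tree's OWN
vocabulary for lattice classes in a `ℚ`-algebra — `Literature.NumberTheory.Automorphic.IsFullLattice D M` («a finitely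
generated additive subgroup `M ⊆ D` with `ℚ·M = D`») and `Literature.NumberTheory.Automorphic.HasFiniteClassSet D Λ`
(«the full right `Λ`-lattices `M ⊆ D` (`MΛ ⊆ M`) lie in finitely many orbits under left multiplication by `Dˣ`»,
`NumberTheory/Automorphic/JordanZassenhaus.lean`, where the theorem is PROVED for orders in quaternion algebras and,
on the way, for orders in DIVISION algebras — `hasFiniteClassSet_of_forall_isUnit` — together with the change-of-order
lemmas `HasFiniteClassSet.of_order` ∕ `.of_smul_mem` and the window finiteness `finite_setOf_le_and_smul_mem`).
THEOREMS ONLY: no definition, no instance, no named fact (D-0026, net Literature debt `0`), no `sorry`.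

A product `Y = ∏ᵢ Lᵢ` of `t ≥ 2` number fields is NOT a division algebra, so the division case does not apply to
it; what this file adds is the PRODUCT STEP (Hertling–Larabi's Cor. 6.2 (b): a full lattice stable under the
maximal order `𝒪_Y = ⊕ᵢ 𝒪_{Lᵢ}` is the direct sum `⊕ᵢ 1_{Lᵢ}·L` of full `𝒪_{Lᵢ}`-lattices, so its `Y^×`-orbit is
the product of the orbits of its components) and the assembly (change of order from `𝒪_Y` to an arbitrary `Λ`).

## Sources, VERBATIM

* C. Hertling, K. Larabi, *Semigroups from full lattices in commutative ℚ-algebras*, arXiv:2602.14973 (2026)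
  [HertlingLarabi2026], held text `paper:arxiv-2602.14973` (TeX chunks).  §1 (chunk p0003): «`𝓛(A) := {L ⊂ A | L`
  is a `ℤ`-lattice which generates `A` over `ℚ}`. The elements of `𝓛(A)` are called full lattices. […] A full
  lattice `Λ` in `A` is an order if `1_A ∈ Λ` and `Λ·Λ ⊂ Λ` […] For each full lattice `L` in `A`, `𝒪(L) := L : L`
  is an order and is called the order of `L`. […] `L_1 ∼_ε L_2 ⟺_Def ∃ a ∈ A^{unit}` with `aL_1 = L_2`, where
  `A^{unit} :=` (the group of units in `A`).»  §6 (chunk p0015): «Throughout the whole paper `A` is […] a finite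
  dimensional commutative ℚ-algebra with unit element `1_A`.  It is separable if its radical `R` is `0`.  Then `A`
  is a direct sum of algebraic number fields. […] **Corollary 6.2.** Let `A` be separable, so `A = ⊕_{j=1}^k A^{(j)}`
  with `A^{(1)}, …, A^{(k)}` algebraic number fields. […] (a) `A` has a maximal order `Λ_max(A)`, which contains all
  other orders. It is `Λ_max(A) = ⊕_{j=1}^k Λ_max(A^{(j)})`. (b) Each full lattice `L` with `𝒪(L) = Λ_max(A)` is a
  direct sum `L = ⊕_{j=1}^k L^{(j)}` where `L^{(j)}` is a full lattice in `A^{(j)}` […] Proof: […]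
  `1_{A^{(j)}} ∈ Λ_max(A^{(j)}) ⊂ Λ_max(A)`. Therefore `L` contains `L^{(j)} := 1_{A^{(j)}}·L` and is the direct sum
  `L = ⊕_{j=1}^k L^{(j)}`. […] The finiteness of the class group in Theorem 6.1 (c) is a very special case of the
  Jordan-Zassenhaus theorem [Za38] (see also [CR62] or [Re03]). This theorem holds also for noncommutative separable
  algebras. In our situation it implies the following finiteness result.  **Theorem 6.3.** (Special case of the
  Jordan-Zassenhaus theorem) Let `A` be separable.  For any order `Λ` in `A` the set
  `{[L]_ε | L ∈ 𝓛(A), 𝒪(L) ⊃ Λ}` of `ε`-classes of `Λ`-ideals is finite.» (Their Thm. 6.4: this FAILS for `A` not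
  separable; Rem. 6.6 (i): «between a given order `Λ` and the maximal order `Λ_max(A)` there are only finitely many
  orders».)  [Za38] = H. Zassenhaus, Abh. Math. Sem. Hamburg 12 (1938); [Re03] = [Reiner2003MaximalOrders];
  [DTZ62] = [DadeTausskyZassenhaus1962] in their bibliography.
* R. G. Swan, E. G. Evans, *K-theory of finite groups and orders*, LNM 149 (1970) [SwanEvans1970], Ch. 3 Thm. 3.9,
  Lemma 3.11 — as formalised in `NumberTheory/Automorphic/JordanZassenhaus.lean` (division case; change of order).
* S. Marseglia, *Computing the ideal class monoid of an order*, J. Lond. Math. Soc. 101 (2020) [Marseglia2019], §2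
  (orders and fractional ideals in a finite product of number fields `K = K_1 × ⋯ × K_r`; «`ICM(R)` is finite»).

## What is proved (`K` a number field; `Y = ∏ᵢ Lᵢ`, `t` finite, `Lᵢ` number fields; `𝒪_Y` denotes the
## `ℤ`-submodule `Submodule.pi univ (fun i => (integralClosure ℤ (Lᵢ)).toSubmodule)` of vectors of algebraic integers)

* §1 ONE FIELD: `isFullLattice_toSubmodule_integralClosure` (`𝒪_K` is a full lattice),
  `hasFiniteClassSet_toSubmodule_integralClosure` (the full `𝒪_K`-stable lattices of `K` lie in finitely many
  `K^×`-orbits — the division case of the tree's theorem; = finiteness of the class group, Thm. 6.1 (c)),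
  `hasFiniteClassSet_of_isFullLattice_field` (the same for `MΛ ⊆ M`, `Λ ⊂ K` ANY full lattice, e.g. any order).
* §2 THE PRODUCT STEP: `mem_piIntegralSubmodule_iff`, `single_mem_piIntegralSubmodule`,
  `isFullLattice_piIntegralSubmodule` (`𝒪_Y` is a full lattice containing `1` and closed under products),
  `eq_pi_map_proj_of_forall_mul_single_mem` («`L` contains `L^{(j)} := 1_{A^{(j)}}·L` and is the direct sum»: a
  `ℤ`-submodule `M ⊆ Y` with `M·1_{Lᵢ} ⊆ M` for all `i` is `Submodule.pi univ (fun i => M.map (proj i))`),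
  `isFullLattice_map_proj` (its components are full lattices), **`hasFiniteClassSet_piIntegralSubmodule`** (the full
  `𝒪_Y`-stable lattices lie in finitely many `Y^×`-orbits: component by component, `(dᵢ)ᵢ • M = ⊕ᵢ dᵢ•M^{(i)}`).
* §3 THE THEOREM **`hasFiniteClassSet_of_isFullLattice`**: for EVERY full lattice `Λ ⊂ Y` (in particular every
  order `Λ`, Hertling–Larabi's hypothesis; no ring structure on `Λ` is needed) the full lattices `M ⊂ Y` with
  `MΛ ⊆ M` lie in finitely many `Y^×`-orbits (`nℤ𝒪_Y ⊆ Λ` for some `n ≠ 0`, `exists_smul_mem_of_fg`, and the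
  change of order `HasFiniteClassSet.of_order`); `hasFiniteClassSet_of_forall_smul_mem` (hypothesis in the form
  `n𝒪_Y ⊆ Λ` used by g30-#3); and Thm. 6.3 in its printed shape **`finite_quot_isFullLattice_of_isFullLattice`**:
  the quotient of `{M | M full, MΛ ⊆ M}` by `M ∼_ε M′ ⟺ ∃ a ∈ Y^×, a•M = M′` is a `Finite` type
  (`finite_quot_isFullLattice_of_forall_smul_mem_subring` for a subring `𝔯 ⊇ n𝒪_Y`, the shape of the orders
  `ρ⁻¹(M_ι(ℤ))` of `CMAlgebraTorusOrder`).

NOT here: the number of classes (no closed form in general: it is `#ICM(Λ)`, Marseglia; `= ∏ᵢ h(Lᵢ)` for `Λ = 𝒪_Y`,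
g30-#1); non-separable algebras (Thm. 6.4: finiteness fails); the dictionary with CM-algebra tori (row g31-#2).
-/

noncomputable section

open scoped Pointwise nonZeroDivisors NumberField
open Module NumberField Function

namespace Literature.NumberTheory.ComplexMultiplication

open Literature.NumberTheory.Automorphic

/-! ## §1 One number field: `𝒪_K` is a full lattice with the Jordan–Zassenhaus property (division case) -/

section OneField

variable (K : Type) [Field K] [NumberField K]

omit [NumberField K] in
/-- `x ∈ 𝒪_K` (the `ℤ`-submodule underlying `integralClosure ℤ K`) iff `x` is an algebraic integer. [folklore]
[cite: HertlingLarabi2026, §6 Thm. 6.1 (a) («the set of algebraic integers in `A`»), chunk p0015] -/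
theorem mem_toSubmodule_integralClosure_iff {x : K} :
    x ∈ Subalgebra.toSubmodule (integralClosure ℤ K) ↔ IsIntegral ℤ x := by
  rw [Subalgebra.mem_toSubmodule, mem_integralClosure_iff]

/-- `𝒪_K` is the `ℤ`-span of an integral basis (so it is finitely generated). [folklore]
[cite: HertlingLarabi2026, §6 Thm. 6.1 (a), chunk p0015] -/
theorem toSubmodule_integralClosure_eq_span_integralBasis :
    Subalgebra.toSubmodule (integralClosure ℤ K) = Submodule.span ℤ (Set.range (integralBasis K)) := by
  ext x
  rw [mem_toSubmodule_integralClosure_iff, mem_span_integralBasis]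
  constructor
  · intro hx
    exact ⟨⟨x, (mem_integralClosure_iff ℤ K).2 hx⟩, rfl⟩
  · rintro ⟨b, rfl⟩
    exact (mem_integralClosure_iff ℤ K).1 b.2

/-- **`𝒪_K` is a full `ℤ`-lattice of `K`** (finitely generated, and every `x ∈ K` has a nonzero integer multiple
which is an algebraic integer) — «`A` has a maximal order `Λ_max(A)` […] namely the set of algebraic integers in
`A`». [cite: HertlingLarabi2026, §6 Thm. 6.1 (a), chunk p0015] -/
theorem isFullLattice_toSubmodule_integralClosure :
    IsFullLattice K (Subalgebra.toSubmodule (integralClosure ℤ K)) := by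
  refine ⟨?_, fun d => ?_⟩
  · rw [toSubmodule_integralClosure_eq_span_integralBasis]
    exact Submodule.fg_span (Set.finite_range _)
  · obtain ⟨m, hm⟩ := IsIntegral.exists_multiple_integral_of_isLocalization (R := ℤ) ℤ⁰ (Rₘ := ℚ) d
      (Algebra.IsIntegral.isIntegral (R := ℚ) d)
    refine ⟨(m : ℤ), nonZeroDivisors.coe_ne_zero m, ?_⟩
    rw [mem_toSubmodule_integralClosure_iff]
    exact hm

omit [NumberField K] in
/-- `1 ∈ 𝒪_K`. [folklore] [cite: HertlingLarabi2026, §1 («`1_A ∈ Λ`»), chunk p0003] -/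
theorem one_mem_toSubmodule_integralClosure : (1 : K) ∈ Subalgebra.toSubmodule (integralClosure ℤ K) :=
  (mem_toSubmodule_integralClosure_iff K).2 isIntegral_one

omit [NumberField K] in
/-- `𝒪_K` is closed under products. [folklore] [cite: HertlingLarabi2026, §1 («`Λ·Λ ⊂ Λ`»), chunk p0003] -/
theorem mul_mem_toSubmodule_integralClosure {a b : K} (ha : a ∈ Subalgebra.toSubmodule (integralClosure ℤ K))
    (hb : b ∈ Subalgebra.toSubmodule (integralClosure ℤ K)) :
    a * b ∈ Subalgebra.toSubmodule (integralClosure ℤ K) := by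
  rw [mem_toSubmodule_integralClosure_iff] at ha hb ⊢
  exact ha.mul hb

/-- **The full `𝒪_K`-stable lattices of a number field `K` lie in finitely many `K^×`-orbits** (the DIVISION case of
the Jordan–Zassenhaus theorem, `hasFiniteClassSet_of_forall_isUnit`, for the order `𝒪_K` of the field `K`; in class
language: «the group `{[L]_ε | L` is a full lattice with `𝒪(L) = Λ_max(A)}` is finite. It is the class group of `A`»).
[cite: HertlingLarabi2026, §6 Thm. 6.1 (c) and Thm. 6.3, chunk p0015] [cite: SwanEvans1970, Ch. 3 Thm. 3.9] -/
theorem hasFiniteClassSet_toSubmodule_integralClosure :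
    HasFiniteClassSet K (Subalgebra.toSubmodule (integralClosure ℤ K)) :=
  hasFiniteClassSet_of_forall_isUnit (fun _ hx => isUnit_iff_ne_zero.2 hx) (one_mem_toSubmodule_integralClosure K)
    (fun _ ha _ hb => mul_mem_toSubmodule_integralClosure K ha hb) (isFullLattice_toSubmodule_integralClosure K)

/-- **Jordan–Zassenhaus for an ARBITRARY full lattice `Λ` of a number field** (e.g. any order `Λ ⊆ 𝒪_K`): the full
lattices `M ⊂ K` with `MΛ ⊆ M` lie in finitely many `K^×`-orbits — change of order from `𝒪_K` (`nℤ𝒪_K ⊆ Λ` for some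
`n ≠ 0`).  In class language: `ICM(Λ)` is finite (Dade–Taussky–Zassenhaus; Marseglia). [cite: HertlingLarabi2026, §6 Thm. 6.3, chunk p0015]
[cite: DadeTausskyZassenhaus1962, title theorem] [cite: Marseglia2019, §2 («`ICM(R)` is finite»)] [cite: SwanEvans1970, Ch. 3 Lemma 3.11] -/
theorem hasFiniteClassSet_of_isFullLattice_field (Λ : Submodule ℤ K) (hΛ : IsFullLattice K Λ) :
    HasFiniteClassSet K Λ := by
  obtain ⟨n, hn, hnΛ⟩ := exists_smul_mem_of_fg hΛ (isFullLattice_toSubmodule_integralClosure K).1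
  exact HasFiniteClassSet.of_order (one_mem_toSubmodule_integralClosure K)
    (fun _ ha _ hb => mul_mem_toSubmodule_integralClosure K ha hb) (isFullLattice_toSubmodule_integralClosure K).1
    hn hnΛ (hasFiniteClassSet_toSubmodule_integralClosure K)

end OneField

/-! ## §2 The product step: `𝒪_Y = ⊕ᵢ 𝒪_{Lᵢ}`-stable lattices of `Y = ∏ᵢ Lᵢ` are direct sums, orbit by orbit -/

section Product

variable {t : Type} {L : t → Type} [∀ i, Field (L i)] [∀ i, NumberField (L i)] [Fintype t] [DecidableEq t]

omit [Fintype t] [DecidableEq t] [∀ i, NumberField (L i)] in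
/-- `a ∈ 𝒪_Y = ⊕ᵢ 𝒪_{Lᵢ}` iff every component `aᵢ` is an algebraic integer («`Λ_max(A) = ⊕_j Λ_max(A^{(j)})`»).
[cite: HertlingLarabi2026, §6 Cor. 6.2 (a), chunk p0015] -/
theorem mem_piIntegralSubmodule_iff {a : Π i, L i} :
    a ∈ Submodule.pi Set.univ (fun i => Subalgebra.toSubmodule (integralClosure ℤ (L i))) ↔
      ∀ i, IsIntegral ℤ (a i) := by
  rw [Submodule.mem_pi]
  simp only [Set.mem_univ, forall_const, mem_toSubmodule_integralClosure_iff]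

omit [Fintype t] [∀ i, NumberField (L i)] in
/-- The vectors `1_{Lᵢ}·a` (`a` in the `i`-th slot, `0` elsewhere) with `a` integral lie in `𝒪_Y`; in particular the
idempotents `1_{Lᵢ} ∈ 𝒪_Y` («`1_{A^{(j)}} ∈ Λ_max(A^{(j)}) ⊂ Λ_max(A)`»). [cite: HertlingLarabi2026, §6 Cor. 6.2 (proof of (b)), chunk p0015] -/
theorem single_mem_piIntegralSubmodule (i : t) {a : L i} (ha : IsIntegral ℤ a) :
    (Pi.single i a : Π i, L i) ∈ Submodule.pi Set.univ (fun i => Subalgebra.toSubmodule (integralClosure ℤ (L i))) := by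
  rw [mem_piIntegralSubmodule_iff]
  intro j
  by_cases hji : j = i
  · subst hji
    rwa [Pi.single_eq_same]
  · rw [Pi.single_eq_of_ne hji]
    exact isIntegral_zero

omit [Fintype t] [DecidableEq t] [∀ i, NumberField (L i)] in
/-- `1 ∈ 𝒪_Y`. [folklore] [cite: HertlingLarabi2026, §1 («`1_A ∈ Λ`»), chunk p0003; §6 Cor. 6.2 (a), chunk p0015] -/
theorem one_mem_piIntegralSubmodule :
    (1 : Π i, L i) ∈ Submodule.pi Set.univ (fun i => Subalgebra.toSubmodule (integralClosure ℤ (L i))) :=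
  mem_piIntegralSubmodule_iff.2 fun _ => by rw [Pi.one_apply]; exact isIntegral_one

omit [Fintype t] [DecidableEq t] [∀ i, NumberField (L i)] in
/-- `𝒪_Y` is closed under products. [folklore] [cite: HertlingLarabi2026, §1 («`Λ·Λ ⊂ Λ`»), chunk p0003; §6 Cor. 6.2 (a), chunk p0015] -/
theorem mul_mem_piIntegralSubmodule {a b : Π i, L i}
    (ha : a ∈ Submodule.pi Set.univ (fun i => Subalgebra.toSubmodule (integralClosure ℤ (L i))))
    (hb : b ∈ Submodule.pi Set.univ (fun i => Subalgebra.toSubmodule (integralClosure ℤ (L i)))) :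
    a * b ∈ Submodule.pi Set.univ (fun i => Subalgebra.toSubmodule (integralClosure ℤ (L i))) := by
  rw [mem_piIntegralSubmodule_iff] at ha hb ⊢
  exact fun i => by rw [Pi.mul_apply]; exact (ha i).mul (hb i)

omit [DecidableEq t] in
/-- **`𝒪_Y = ⊕ᵢ 𝒪_{Lᵢ}` is a full `ℤ`-lattice of `Y`** (finitely generated; every `y ∈ Y` has a nonzero integer
multiple in `𝒪_Y` — a common multiple of the denominators of its components). [cite: HertlingLarabi2026, §6 Cor. 6.2 (a) («`A` has a maximal order `Λ_max(A)` … `= ⊕_j Λ_max(A^{(j)})`»), chunk p0015] -/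
theorem isFullLattice_piIntegralSubmodule :
    IsFullLattice (Π i, L i) (Submodule.pi Set.univ (fun i => Subalgebra.toSubmodule (integralClosure ℤ (L i)))) := by
  refine ⟨?_, fun d => ?_⟩
  · exact Submodule.fg_pi fun i => (isFullLattice_toSubmodule_integralClosure (L i)).1
  · choose n hn hnd using fun i => (isFullLattice_toSubmodule_integralClosure (L i)).2 (d i)
    refine ⟨∏ i, n i, Finset.prod_ne_zero_iff.2 fun i _ => hn i, mem_piIntegralSubmodule_iff.2 fun i => ?_⟩
    obtain ⟨c, hc⟩ : n i ∣ ∏ j, n j := Finset.dvd_prod_of_mem n (Finset.mem_univ i)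
    rw [Pi.smul_apply, hc, mul_comm, mul_smul]
    exact ((mem_toSubmodule_integralClosure_iff (L i)).1 (hnd i)).smul c

omit [∀ i, NumberField (L i)] in
/-- **«`L` contains `L^{(j)} := 1_{A^{(j)}}·L` and is the direct sum `L = ⊕_j L^{(j)}`»**: a `ℤ`-submodule `M ⊆ Y`
stable under the idempotents, `M·1_{Lᵢ} ⊆ M` for every `i`, is the product `⊕ᵢ M^{(i)}` of its components
`M^{(i)} = projᵢ(M) ⊆ Lᵢ`. [cite: HertlingLarabi2026, §6 Cor. 6.2 (b) and its proof, chunk p0015] -/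
theorem eq_pi_map_proj_of_forall_mul_single_mem (M : Submodule ℤ (Π i, L i))
    (hM : ∀ m ∈ M, ∀ i, m * Pi.single i 1 ∈ M) :
    M = Submodule.pi Set.univ (fun i => M.map (LinearMap.proj i : (Π i, L i) →ₗ[ℤ] L i)) := by
  refine le_antisymm (fun m hm => Submodule.mem_pi.2 fun i _ => Submodule.mem_map_of_mem hm) (fun y hy => ?_)
  rw [Submodule.mem_pi] at hy
  have h : ∀ i, ∃ m ∈ M, m i = y i := fun i => by
    obtain ⟨m, hm, hmi⟩ := Submodule.mem_map.1 (hy i (Set.mem_univ i))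
    exact ⟨m, hm, hmi⟩
  choose m hm hmy using h
  have hy_eq : y = ∑ i, m i * Pi.single i 1 := by
    funext j
    rw [Finset.sum_apply, Finset.sum_eq_single j (fun i _ hij => by
        rw [Pi.mul_apply, Pi.single_eq_of_ne (Ne.symm hij), mul_zero]) (fun hj => absurd (Finset.mem_univ j) hj),
      Pi.mul_apply, Pi.single_eq_same, mul_one, hmy]
  rw [hy_eq]
  exact Submodule.sum_mem _ fun i _ => hM _ (hm i) i

omit [∀ i, NumberField (L i)] [Fintype t] in
/-- **The components `L^{(j)}` of a full lattice are full lattices** («where `L^{(j)}` is a full lattice in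
`A^{(j)}`»): `projᵢ(M)` is finitely generated and absorbs an integer multiple of every `x ∈ Lᵢ`. [cite: HertlingLarabi2026, §6 Cor. 6.2 (b), chunk p0015] -/
theorem isFullLattice_map_proj {M : Submodule ℤ (Π i, L i)} (hM : IsFullLattice (Π i, L i) M) (i : t) :
    IsFullLattice (L i) (M.map (LinearMap.proj i : (Π i, L i) →ₗ[ℤ] L i)) := by
  refine ⟨hM.1.map _, fun x => ?_⟩
  obtain ⟨n, hn, hnx⟩ := hM.2 (Pi.single i x)
  refine ⟨n, hn, Submodule.mem_map.2 ⟨_, hnx, ?_⟩⟩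
  rw [map_zsmul, LinearMap.proj_apply, Pi.single_eq_same]

/-- **THE PRODUCT STEP — the full `𝒪_Y`-stable lattices of `Y = ∏ᵢ Lᵢ` lie in finitely many `Y^×`-orbits**: such an
`M` is `⊕ᵢ M^{(i)}` with `M^{(i)}` a full `𝒪_{Lᵢ}`-stable lattice of `Lᵢ` (§1: `M^{(i)} ∈ dᵢ⁻¹ Tᵢ` for finite sets
`Tᵢ`), and `(dᵢ)ᵢ • M = ⊕ᵢ dᵢ•M^{(i)}` lies in the finite set of products of members of the `Tᵢ` («(c) The group
`G([Λ_max]_ε)` is finite and isomorphic to the product `∏_j G([Λ_max(A^{(j)})]_ε)` of the class groups»).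
[cite: HertlingLarabi2026, §6 Cor. 6.2 (b)(c), chunk p0015] [cite: SwanEvans1970, Ch. 3 Thm. 3.9] -/
theorem hasFiniteClassSet_piIntegralSubmodule :
    HasFiniteClassSet (Π i, L i) (Submodule.pi Set.univ (fun i => Subalgebra.toSubmodule (integralClosure ℤ (L i)))) := by
  classical
  choose T hT using fun i => hasFiniteClassSet_toSubmodule_integralClosure (L i)
  refine ⟨(Fintype.piFinset T).image fun N => Submodule.pi Set.univ N, fun M hM hMO => ?_⟩
  -- the components `M^{(i)}` and their orbit representatives
  have hMi : ∀ i, ∀ m ∈ M.map (LinearMap.proj i : (Π i, L i) →ₗ[ℤ] L i),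
      ∀ a ∈ Subalgebra.toSubmodule (integralClosure ℤ (L i)), m * a ∈ M.map (LinearMap.proj i : (Π i, L i) →ₗ[ℤ] L i) := by
    intro i m hm a ha
    obtain ⟨m', hm', rfl⟩ := Submodule.mem_map.1 hm
    refine Submodule.mem_map.2 ⟨m' * Pi.single i a, hMO _ hm' _
      (single_mem_piIntegralSubmodule i ((mem_toSubmodule_integralClosure_iff (L i)).1 ha)), ?_⟩
    rw [LinearMap.proj_apply, LinearMap.proj_apply, Pi.mul_apply, Pi.single_eq_same]
  choose d hd using fun i => hT i _ (isFullLattice_map_proj hM i) (hMi i)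
  -- the unit `u = (dᵢ)ᵢ` of `Y`
  let u : (Π i, L i)ˣ :=
    ⟨fun i => (d i : L i), fun i => ((d i)⁻¹ : (L i)ˣ), funext fun i => (d i).mul_inv, funext fun i => (d i).inv_mul⟩
  have hMpi := eq_pi_map_proj_of_forall_mul_single_mem M fun m hm i =>
    hMO m hm _ (single_mem_piIntegralSubmodule i isIntegral_one)
  have huM : u • M = Submodule.pi Set.univ (fun i => d i • M.map (LinearMap.proj i : (Π i, L i) →ₗ[ℤ] L i)) := by
    ext y
    rw [mem_units_smul_submodule_iff, Submodule.mem_pi]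
    conv_lhs => rw [hMpi, Submodule.mem_pi]
    refine forall_congr' fun i => forall_congr' fun _ => ?_
    rw [mem_units_smul_submodule_iff]
    rfl
  refine ⟨u, Finset.mem_image.2 ⟨fun i => d i • M.map (LinearMap.proj i : (Π i, L i) →ₗ[ℤ] L i),
    Fintype.mem_piFinset.2 fun i => hd i, huM.symm⟩⟩

end Product

/-! ## §3 The theorem: every full lattice `Λ ⊂ Y` has the Jordan–Zassenhaus property; Thm. 6.3 as printed -/

section Theorem

variable {t : Type} {L : t → Type} [∀ i, Field (L i)] [∀ i, NumberField (L i)] [Fintype t] [DecidableEq t]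

omit [DecidableEq t] in
/-- **JORDAN–ZASSENHAUS ∕ DADE–TAUSSKY–ZASSENHAUS FOR `Y = L_1 ⊕ ⋯ ⊕ L_t`** (Hertling–Larabi Thm. 6.3, the
separable commutative case): for EVERY full `ℤ`-lattice `Λ ⊂ Y` — in particular for every order `Λ` of `Y` — the
full lattices `M ⊂ Y` with `MΛ ⊆ M` (the `Λ`-ideals, when `Λ` is an order: `𝒪(M) ⊃ Λ`) lie in FINITELY MANY orbits
under multiplication by units of `Y`.  Proof: `nℤ·𝒪_Y ⊆ Λ` for some integer `n ≠ 0` (`Λ` is full, `𝒪_Y` finitely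
generated), and the property descends from `𝒪_Y` (§2) along `nℤ𝒪_Y ⊆ Λ` by the change of order (finitely many
lattices between `n·M𝒪_Y` and `M𝒪_Y`). [cite: HertlingLarabi2026, §6 Thm. 6.3 («For any order `Λ` in `A` the set `{[L]_ε | L ∈ 𝓛(A), 𝒪(L) ⊃ Λ}` of `ε`-classes of `Λ`-ideals is finite»), chunk p0015]
[cite: DadeTausskyZassenhaus1962, title theorem] [cite: SwanEvans1970, Ch. 3 Thm. 3.9, Lemma 3.11] [cite: Reiner2003MaximalOrders, §26 Thm. (26.4)] -/
theorem hasFiniteClassSet_of_isFullLattice (Λ : Submodule ℤ (Π i, L i)) (hΛ : IsFullLattice (Π i, L i) Λ) :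
    HasFiniteClassSet (Π i, L i) Λ := by
  classical
  obtain ⟨n, hn, hnΛ⟩ := exists_smul_mem_of_fg hΛ (isFullLattice_piIntegralSubmodule (L := L)).1
  exact HasFiniteClassSet.of_order one_mem_piIntegralSubmodule (fun _ ha _ hb => mul_mem_piIntegralSubmodule ha hb)
    (isFullLattice_piIntegralSubmodule (L := L)).1 hn hnΛ hasFiniteClassSet_piIntegralSubmodule

omit [DecidableEq t] in
/-- The same with the hypothesis in the shape `n𝒪_Y ⊆ Λ` (`n ≠ 0`; no fullness or ring structure of `Λ` needed) —
the form in which the orders `𝔯 = ρ⁻¹(M_ι(ℤ))` of CM-algebra tori satisfy it (`CMAlgebraTorusOrder`,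
`exists_pos_nat_forall_smul_mem_order`). [cite: HertlingLarabi2026, §6 Thm. 6.3 and Rem. 6.6 (i), chunk p0015] [cite: SwanEvans1970, Ch. 3 Lemma 3.11] -/
theorem hasFiniteClassSet_of_forall_smul_mem (Λ : Submodule ℤ (Π i, L i)) {n : ℤ} (hn : n ≠ 0)
    (hnΛ : ∀ a : Π i, L i, (∀ i, IsIntegral ℤ (a i)) → n • a ∈ Λ) :
    HasFiniteClassSet (Π i, L i) Λ := by
  classical
  exact HasFiniteClassSet.of_order one_mem_piIntegralSubmodule (fun _ ha _ hb => mul_mem_piIntegralSubmodule ha hb)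
    (isFullLattice_piIntegralSubmodule (L := L)).1 hn (fun a ha => hnΛ a (mem_piIntegralSubmodule_iff.1 ha))
    hasFiniteClassSet_piIntegralSubmodule

omit [Fintype t] [DecidableEq t] [∀ i, NumberField (L i)] in
/-- From a finite set of orbit representatives to a `Finite` quotient: if every full `M` with `MΛ ⊆ M` has `a•M ∈ T`
for a unit `a`, the `ε`-classes (`M ∼_ε M′ ⟺ ∃ a ∈ Y^×, a•M = M′`) of such `M` form a finite type — each class is
the class of a member of `T`. [cite: HertlingLarabi2026, §1 («`L_1 ∼_ε L_2 ⟺ ∃ a ∈ A^{unit}` with `aL_1 = L_2`»), chunk p0003; §6 Thm. 6.3, chunk p0015] -/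
theorem finite_quot_isFullLattice_of_hasFiniteClassSet {Λ : Submodule ℤ (Π i, L i)}
    (h : HasFiniteClassSet (Π i, L i) Λ) :
    Finite (Quot fun M M' : {M : Submodule ℤ (Π i, L i) //
        IsFullLattice (Π i, L i) M ∧ ∀ m ∈ M, ∀ a ∈ Λ, m * a ∈ M} =>
      ∃ a : (Π i, L i)ˣ, a • (M : Submodule ℤ (Π i, L i)) = M') := by
  classical
  obtain ⟨T, hT⟩ := h
  -- the members of `T` which are themselves full `Λ`-lattices represent every class
  let S := {N : {M : Submodule ℤ (Π i, L i) // IsFullLattice (Π i, L i) M ∧ ∀ m ∈ M, ∀ a ∈ Λ, m * a ∈ M} //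
    (N : Submodule ℤ (Π i, L i)) ∈ T}
  haveI : Finite S := by
    refine Finite.of_injective (fun N : S => (⟨(N.1 : Submodule ℤ (Π i, L i)), N.2⟩ : (T : Set (Submodule ℤ (Π i, L i)))))
      fun N N' hNN' => Subtype.ext (Subtype.ext ?_)
    exact congrArg (fun x : (T : Set (Submodule ℤ (Π i, L i))) => (x : Submodule ℤ (Π i, L i))) hNN'
  refine Finite.of_surjective (fun N : S => Quot.mk _ N.1) fun c => ?_
  induction c using Quot.ind with
  | mk M =>
    obtain ⟨a, ha⟩ := hT M.1 M.2.1 M.2.2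
    -- `a • M` is again a full `Λ`-lattice
    have hfull : IsFullLattice (Π i, L i) (a • (M : Submodule ℤ (Π i, L i))) := by
      refine ⟨?_, fun d => ?_⟩
      · rw [Units.smul_def]
        exact M.2.1.1.map _
      · obtain ⟨n, hn, hnd⟩ := M.2.1.2 ((a⁻¹ : (Π i, L i)ˣ) • d)
        refine ⟨n, hn, mem_units_smul_submodule_iff.2 ?_⟩
        rwa [smul_comm]
    have hstab : ∀ m ∈ a • (M : Submodule ℤ (Π i, L i)), ∀ b ∈ Λ, m * b ∈ a • (M : Submodule ℤ (Π i, L i)) := by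
      intro m hm b hb
      rw [mem_units_smul_submodule_iff] at hm ⊢
      have hmb : (a⁻¹ : (Π i, L i)ˣ) • (m * b) = (a⁻¹ : (Π i, L i)ˣ) • m * b := by
        rw [Units.smul_def, Units.smul_def, smul_eq_mul, smul_eq_mul, mul_assoc]
      rw [hmb]
      exact M.2.2 _ hm b hb
    refine ⟨⟨⟨a • (M : Submodule ℤ (Π i, L i)), hfull, hstab⟩, ha⟩, ?_⟩
    exact (Quot.sound ⟨a, rfl⟩).symm

omit [DecidableEq t] in
/-- **THEOREM 6.3 AS PRINTED — «the set `{[L]_ε | L ∈ 𝓛(A), 𝒪(L) ⊃ Λ}` of `ε`-classes of `Λ`-ideals is finite»**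
for `A = Y = L_1 ⊕ ⋯ ⊕ L_t` and ANY full lattice `Λ` (every order of `Y` is one): the full lattices `M ⊂ Y` with
`MΛ ⊆ M`, modulo `M ∼_ε M′ ⟺ ∃ a ∈ Y^×, a•M = M′`, form a FINITE type. [cite: HertlingLarabi2026, §6 Thm. 6.3, chunk p0015] [cite: DadeTausskyZassenhaus1962, title theorem]
[cite: Marseglia2019, §2 («`ICM(R)` is finite», `K` a finite product of number fields)] -/
theorem finite_quot_isFullLattice_of_isFullLattice (Λ : Submodule ℤ (Π i, L i)) (hΛ : IsFullLattice (Π i, L i) Λ) :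
    Finite (Quot fun M M' : {M : Submodule ℤ (Π i, L i) //
        IsFullLattice (Π i, L i) M ∧ ∀ m ∈ M, ∀ a ∈ Λ, m * a ∈ M} =>
      ∃ a : (Π i, L i)ˣ, a • (M : Submodule ℤ (Π i, L i)) = M') :=
  finite_quot_isFullLattice_of_hasFiniteClassSet (hasFiniteClassSet_of_isFullLattice Λ hΛ)

omit [DecidableEq t] in
/-- **Thm. 6.3 for a SUBRING `𝔯 ⊇ n𝒪_Y` of `Y`** (`n ≠ 0`) — the shape of the orders `𝔯 = ρ⁻¹(M_ι(ℤ))` of tori with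
multiplication by `Y` (`CMAlgebraTorusOrder.exists_pos_nat_forall_smul_mem_order`): the full lattices `M ⊂ Y` with
`M𝔯 ⊆ M`, modulo units of `Y`, form a finite type. [cite: HertlingLarabi2026, §6 Thm. 6.3, chunk p0015] [cite: Shimura1998, §7.1 («`𝔯` is an order in `𝔎`»), p. 47; §18.7, p. 129] -/
theorem finite_quot_isFullLattice_of_forall_smul_mem_subring (𝔯 : Subring (Π i, L i)) {n : ℤ} (hn : n ≠ 0)
    (hn𝔯 : ∀ a : Π i, L i, (∀ i, IsIntegral ℤ (a i)) → n • a ∈ 𝔯) :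
    Finite (Quot fun M M' : {M : Submodule ℤ (Π i, L i) //
        IsFullLattice (Π i, L i) M ∧ ∀ m ∈ M, ∀ a ∈ 𝔯, m * a ∈ M} =>
      ∃ a : (Π i, L i)ˣ, a • (M : Submodule ℤ (Π i, L i)) = M') := by
  have h := hasFiniteClassSet_of_forall_smul_mem (L := L) (AddSubgroup.toIntSubmodule 𝔯.toAddSubgroup) hn
    (fun a ha => hn𝔯 a ha)
  exact finite_quot_isFullLattice_of_hasFiniteClassSet h

end Theorem

end Literature.NumberTheory.ComplexMultiplication
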